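import Mathlib
import Literature.Analysis.FluidPDE.VectorCalculus
import Summits.NavierStokesRegularity.NavierStokesRegularity.Theorems.FilamentSkeletonRssMatchedKernelDifferentiable
import Summits.NavierStokesRegularity.NavierStokesRegularity.Theorems.FilamentSkeletonRssClause13RScalingAnnihilator
import Summits.NavierStokesRegularity.NavierStokesRegularity.Theorems.FilamentSkeletonRssClause13RNonlocalAdjoint
import Summits.NavierStokesRegularity.NavierStokesRegularity.Theorems.FilamentSkeletonRssClause13RStationDecay

/-!
# Clause 13-R, route (ii′) item (a), part 3: PAIRWISE ADJOINT IDENTITIES for the Biot–Savart variation kernel of the closed form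
# (crux `Clause13RNearStraightL`, stmt-NavierStokesRegularity-23612; line `rate_bordered_split`, STUB R `stub_rateRow13RFlat`)

Route `FilamentSkeletonRss`, Variant A1R.  The closed form `…Clause13LinearisedMapClauses.deriv_linearisedMap_inBall` contains, for each pair of
filaments `(j, k)`, the `σ`-integral of the VARIATION KERNEL
`I(σ) = (−3⟪y − Xσ, y_Y − Yσ⟫K₅)•(X′σ × (y − Xσ)) + K₃•(X′σ × (y_Y − Yσ) + Y′σ × (y − Xσ))`, `K_p = ((‖y − Xσ‖² + mσ)^{p/2})⁻¹`,
with `y = X_jτ`, `y_Y = Y_jτ`, `X = X_k`, `Y = Y_k`, `m = κ·Aa_k`.  For the pairing identity `Σ_j ∫_{S_j} ⟪ψ_j, DT·Y_j⟫ = Σ_k ∫ ⟪(DT)^*ψ_k, Y_k⟫`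
(census item (a) of memo STRUCTURE-23612-conformal-cokernel-leafhand8-g1.md, behind `…Clause13RCokernelCertificate`) this file supplies, per pair and
with the LITERAL kernel shapes (decay integrability at a station: `…Clause13RStationDecay`): §1
**`integral_variation_split`** `∫ I = ∫ I_loc + ∫ I_Y + ∫ I_{Y′}` (local in `y_Y`, nonlocal in `Yσ`, and the `Y′σ` part); §2 **`inner_integral_local_eq`**
`⟪φ, ∫ I_loc⟫ = ⟪∫ L^⊤φ, y_Y⟫`, `L^⊤(σ)φ = (−3K₅⟪φ, X′σ × (y − Xσ)⟫)•(y − Xσ) + K₃•(φ × X′σ)`; §3 **`setIntegral_inner_integral_nonlocal_eq`**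
`∫_S ⟪φτ, ∫ I_Y dσ⟫dτ = ∫ ⟪∫_S [(3K₅⟪φτ, X′σ × (yτ − Xσ)⟫)•(yτ − Xσ) − K₃•(φτ × X′σ)] dτ, Yσ⟫dσ` (Fubini, `…Clause13RNonlocalAdjoint`); §4
**`setIntegral_inner_integral_derivTerm_eq`** `∫_S ⟪φτ, ∫ K₃•(Y′σ × (yτ − Xσ)) dσ⟫dτ = −∫ ⟪∫_S G′(τ,σ) dτ, Yσ⟫dσ`,
`G′ = (3⟪yτ − Xσ, X′σ⟫((‖yτ − Xσ‖² + a₀)^{5/2})⁻¹)•(φτ × (Xσ − yτ)) + ((‖yτ − Xσ‖² + a₀)^{3/2})⁻¹•(φτ × X′σ)` (core `= a₀` on an open `U ⊇ tsupport Y`,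
clause 13).  What remains of item (a) is bookkeeping (linearity over `k`, `⟪ψ, P_n V⟫ = ⟪P_nψ, V⟫`, the local terms `½Y − α e₃ × Y`, the slip
term of `…Clause13RSlipAdjoint`, the sum over `j`).  Hand `leafhand-ns-filamentskeletonrs-10-g0` (LAND-ONLY); `--supports stmt-NavierStokesRegularity-23612`
helper.  HONEST FRAMING: calculus for the clause-level pairing at a HYPOTHETICAL near-straight filament skeleton on the NEGATIVE side of a MODEL blow-up
route; STUB R is NOT proved here and nothing in this file bears on Navier–Stokes regularity or blow-up.
-/

noncomputable section

open MeasureTheory Filter Topology Set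
open scoped RealInnerProductSpace InnerProductSpace
open Literature.Analysis.FluidPDE
open Summit.NavierStokesRegularity.NavierStokesRegularity.Theorems.Clause13RStationDecay
open Summit.NavierStokesRegularity.NavierStokesRegularity.Theorems.Clause13RScalingAnnihilator (inner_cross_cyclic)
open Summit.NavierStokesRegularity.NavierStokesRegularity.Theorems.Clause13RNonlocalAdjoint
  (setIntegral_integral_swap_of_continuous setIntegral_inner_const integral_inner_kernel_cross_deriv_eq_neg)

namespace Summit.NavierStokesRegularity.NavierStokesRegularity.Theorems.Clause13RPairwiseAdjoint
set_option linter.dupNamespace false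

/-! ## §1 The split of the variation kernel at a station -/

/-- Pointwise split of the variation kernel: `I = I_loc + I_Y + I_{Y′}`. [folklore] -/
theorem variation_kernel_split (y yY x a z z' : EuclideanSpace ℝ (Fin 3)) (k5 k3 : ℝ) :
    (-3 * ⟪y - x, yY - z⟫ * k5) • cross a (y - x) + k3 • (cross a (yY - z) + cross z' (y - x))
      = ((-3 * ⟪y - x, yY⟫ * k5) • cross a (y - x) + k3 • cross a yY)
        + ((3 * ⟪y - x, z⟫ * k5) • cross a (y - x) - k3 • cross a z)
        + k3 • cross z' (y - x) := by
  have hc : cross a (yY - z) = cross a yY - cross a z := by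
    rw [← crossCLM_apply, map_sub]; rfl
  rw [hc, inner_sub_right, smul_add, smul_sub]
  have : (-3 * (⟪y - x, yY⟫ - ⟪y - x, z⟫) * k5) = (-3 * ⟪y - x, yY⟫ * k5) + (3 * ⟪y - x, z⟫ * k5) := by ring
  rw [this, add_smul]
  abel

/-- **THE SPLIT `∫ I = ∫ I_loc + ∫ I_Y + ∫ I_{Y′}` at a station**, with the integrability of each piece: `X ∈ C¹` with `‖X′‖ ≤ 1` and cone growth,
core `m` continuous with floor `m₀ > 0`, test field `Y ∈ C¹` with compact support. [folklore] -/
theorem integral_variation_split {X Y : ℝ → EuclideanSpace ℝ (Fin 3)} {m : ℝ → ℝ} {m₀ c C : ℝ}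
    (y yY : EuclideanSpace ℝ (Fin 3)) (hm₀ : 0 < m₀) (hm : ∀ σ, m₀ ≤ m σ) (hmc : Continuous m) (hc : 0 < c)
    (hX : ContDiff ℝ 1 X) (hX1 : ∀ σ, ‖deriv X σ‖ ≤ 1) (hXg : ∀ σ, c * |σ| - C ≤ ‖X σ‖)
    (hY : ContDiff ℝ 1 Y) (hYc : HasCompactSupport Y) :
    ∫ σ, ((-3 * ⟪y - X σ, yY - Y σ⟫ * ((‖y - X σ‖ ^ 2 + m σ) ^ (5 / 2 : ℝ))⁻¹) • cross (deriv X σ) (y - X σ)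
        + ((‖y - X σ‖ ^ 2 + m σ) ^ (3 / 2 : ℝ))⁻¹ • (cross (deriv X σ) (yY - Y σ) + cross (deriv Y σ) (y - X σ)))
      = (∫ σ, ((-3 * ⟪y - X σ, yY⟫ * ((‖y - X σ‖ ^ 2 + m σ) ^ (5 / 2 : ℝ))⁻¹) • cross (deriv X σ) (y - X σ)
          + ((‖y - X σ‖ ^ 2 + m σ) ^ (3 / 2 : ℝ))⁻¹ • cross (deriv X σ) yY))
        + (∫ σ, ((3 * ⟪y - X σ, Y σ⟫ * ((‖y - X σ‖ ^ 2 + m σ) ^ (5 / 2 : ℝ))⁻¹) • cross (deriv X σ) (y - X σ)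
          - ((‖y - X σ‖ ^ 2 + m σ) ^ (3 / 2 : ℝ))⁻¹ • cross (deriv X σ) (Y σ)))
        + ∫ σ, ((‖y - X σ‖ ^ 2 + m σ) ^ (3 / 2 : ℝ))⁻¹ • cross (deriv Y σ) (y - X σ) := by
  have hXc : Continuous X := hX.continuous
  have hX'c : Continuous (deriv X) := hX.continuous_deriv le_rfl
  have hYcont : Continuous Y := hY.continuous
  have hY'c : Continuous (deriv Y) := hY.continuous_deriv le_rfl
  have hmpos : ∀ σ, 0 < m σ := fun σ => hm₀.trans_le (hm σ)
  have hk5 := continuous_kernel hXc hmc hmpos y (5 / 2 : ℝ)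
  have hk3 := continuous_kernel hXc hmc hmpos y (3 / 2 : ℝ)
  have hd : Continuous fun σ => y - X σ := continuous_const.sub hXc
  have hcr1 : Continuous fun σ => cross (deriv X σ) (y - X σ) := (crossCLM.continuous.comp hX'c).clm_apply hd
  -- (1) the local piece: decaying kernels
  have h1a : Integrable fun σ => (-3 * ⟪y - X σ, yY⟫ * ((‖y - X σ‖ ^ 2 + m σ) ^ (5 / 2 : ℝ))⁻¹) • cross (deriv X σ) (y - X σ) :=
    integrable_of_norm_le_inv y hm₀ hm hc hXg ((((continuous_const.mul (hd.inner continuous_const)).mul hk5)).smul hcr1)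
      (by positivity) fun σ => norm_kernel5_term_le hm₀ (hm σ) (hX1 σ)
  have h1b : Integrable fun σ => ((‖y - X σ‖ ^ 2 + m σ) ^ (3 / 2 : ℝ))⁻¹ • cross (deriv X σ) yY :=
    integrable_of_norm_le_inv y hm₀ hm hc hXg (hk3.smul ((crossCLM.continuous.comp hX'c).clm_apply continuous_const))
      (by positivity) fun σ => norm_kernel3_cross_le hm₀ (hm σ) (hX1 σ)
  -- (2) the nonlocal `Y` piece and (3) the `Y′` piece: continuous with compact support
  have h2c : Continuous fun σ => (3 * ⟪y - X σ, Y σ⟫ * ((‖y - X σ‖ ^ 2 + m σ) ^ (5 / 2 : ℝ))⁻¹) • cross (deriv X σ) (y - X σ)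
      - ((‖y - X σ‖ ^ 2 + m σ) ^ (3 / 2 : ℝ))⁻¹ • cross (deriv X σ) (Y σ) :=
    (((continuous_const.mul (hd.inner hYcont)).mul hk5).smul hcr1).sub
      (hk3.smul ((crossCLM.continuous.comp hX'c).clm_apply hYcont))
  have h2 : Integrable fun σ => (3 * ⟪y - X σ, Y σ⟫ * ((‖y - X σ‖ ^ 2 + m σ) ^ (5 / 2 : ℝ))⁻¹) • cross (deriv X σ) (y - X σ)
      - ((‖y - X σ‖ ^ 2 + m σ) ^ (3 / 2 : ℝ))⁻¹ • cross (deriv X σ) (Y σ) := by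
    refine h2c.integrable_of_hasCompactSupport (HasCompactSupport.intro hYc fun σ hσ => ?_)
    rw [image_eq_zero_of_notMem_tsupport hσ, inner_zero_right,
      ← crossCLM_apply (deriv X σ) (0 : EuclideanSpace ℝ (Fin 3)), map_zero]
    simp
  have h3c : Continuous fun σ => ((‖y - X σ‖ ^ 2 + m σ) ^ (3 / 2 : ℝ))⁻¹ • cross (deriv Y σ) (y - X σ) :=
    hk3.smul ((crossCLM.continuous.comp hY'c).clm_apply hd)
  have h3 : Integrable fun σ => ((‖y - X σ‖ ^ 2 + m σ) ^ (3 / 2 : ℝ))⁻¹ • cross (deriv Y σ) (y - X σ) := by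
    refine h3c.integrable_of_hasCompactSupport (HasCompactSupport.intro hYc.deriv fun σ hσ => ?_)
    rw [image_eq_zero_of_notMem_tsupport hσ, ← crossCLM_apply (0 : EuclideanSpace ℝ (Fin 3)), map_zero]
    simp
  have h1' : Integrable fun σ => (-3 * ⟪y - X σ, yY⟫ * ((‖y - X σ‖ ^ 2 + m σ) ^ (5 / 2 : ℝ))⁻¹) • cross (deriv X σ) (y - X σ)
      + ((‖y - X σ‖ ^ 2 + m σ) ^ (3 / 2 : ℝ))⁻¹ • cross (deriv X σ) yY := h1a.add h1b
  have h12 : Integrable fun σ => ((-3 * ⟪y - X σ, yY⟫ * ((‖y - X σ‖ ^ 2 + m σ) ^ (5 / 2 : ℝ))⁻¹) • cross (deriv X σ) (y - X σ)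
          + ((‖y - X σ‖ ^ 2 + m σ) ^ (3 / 2 : ℝ))⁻¹ • cross (deriv X σ) yY)
        + ((3 * ⟪y - X σ, Y σ⟫ * ((‖y - X σ‖ ^ 2 + m σ) ^ (5 / 2 : ℝ))⁻¹) • cross (deriv X σ) (y - X σ)
          - ((‖y - X σ‖ ^ 2 + m σ) ^ (3 / 2 : ℝ))⁻¹ • cross (deriv X σ) (Y σ)) := h1'.add h2
  have hptw : (fun σ => (-3 * ⟪y - X σ, yY - Y σ⟫ * ((‖y - X σ‖ ^ 2 + m σ) ^ (5 / 2 : ℝ))⁻¹) • cross (deriv X σ) (y - X σ)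
        + ((‖y - X σ‖ ^ 2 + m σ) ^ (3 / 2 : ℝ))⁻¹ • (cross (deriv X σ) (yY - Y σ) + cross (deriv Y σ) (y - X σ)))
      = fun σ => ((-3 * ⟪y - X σ, yY⟫ * ((‖y - X σ‖ ^ 2 + m σ) ^ (5 / 2 : ℝ))⁻¹) • cross (deriv X σ) (y - X σ)
          + ((‖y - X σ‖ ^ 2 + m σ) ^ (3 / 2 : ℝ))⁻¹ • cross (deriv X σ) yY)
        + ((3 * ⟪y - X σ, Y σ⟫ * ((‖y - X σ‖ ^ 2 + m σ) ^ (5 / 2 : ℝ))⁻¹) • cross (deriv X σ) (y - X σ)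
          - ((‖y - X σ‖ ^ 2 + m σ) ^ (3 / 2 : ℝ))⁻¹ • cross (deriv X σ) (Y σ))
        + ((‖y - X σ‖ ^ 2 + m σ) ^ (3 / 2 : ℝ))⁻¹ • cross (deriv Y σ) (y - X σ) := by
    funext σ; exact variation_kernel_split y yY (X σ) (deriv X σ) (Y σ) (deriv Y σ) _ _
  rw [hptw, integral_add h12 h3, integral_add h1' h2]

/-! ## §2 Transposition of the local part -/

/-- Pointwise transposition of the local kernel: `⟪φ, L(σ) v⟫ = ⟪L^⊤(σ)φ, v⟫`. [folklore] -/
theorem inner_local_kernel_eq (φ v d a : EuclideanSpace ℝ (Fin 3)) (k5 k3 : ℝ) :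
    ⟪φ, (-3 * ⟪d, v⟫ * k5) • cross a d + k3 • cross a v⟫
      = ⟪(-3 * k5 * ⟪φ, cross a d⟫) • d + k3 • cross φ a, v⟫ := by
  rw [inner_add_right, inner_smul_right, inner_smul_right, inner_add_left, inner_smul_left, inner_smul_left,
    inner_cross_cyclic φ a v]
  simp only [conj_trivial]
  ring

/-- **The local part transposed**: `⟪φ, ∫ I_loc dσ⟫ = ⟪∫ L^⊤(σ)φ dσ, y_Y⟫` (both integrands decay along the proper axis). [folklore] -/
theorem inner_integral_local_eq {X : ℝ → EuclideanSpace ℝ (Fin 3)} {m : ℝ → ℝ} {m₀ c C : ℝ}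
    (φ y yY : EuclideanSpace ℝ (Fin 3)) (hm₀ : 0 < m₀) (hm : ∀ σ, m₀ ≤ m σ) (hmc : Continuous m) (hc : 0 < c)
    (hX : ContDiff ℝ 1 X) (hX1 : ∀ σ, ‖deriv X σ‖ ≤ 1) (hXg : ∀ σ, c * |σ| - C ≤ ‖X σ‖) :
    ⟪φ, ∫ σ, ((-3 * ⟪y - X σ, yY⟫ * ((‖y - X σ‖ ^ 2 + m σ) ^ (5 / 2 : ℝ))⁻¹) • cross (deriv X σ) (y - X σ)
          + ((‖y - X σ‖ ^ 2 + m σ) ^ (3 / 2 : ℝ))⁻¹ • cross (deriv X σ) yY)⟫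
      = ⟪∫ σ, ((-3 * ((‖y - X σ‖ ^ 2 + m σ) ^ (5 / 2 : ℝ))⁻¹ * ⟪φ, cross (deriv X σ) (y - X σ)⟫) • (y - X σ)
          + ((‖y - X σ‖ ^ 2 + m σ) ^ (3 / 2 : ℝ))⁻¹ • cross φ (deriv X σ)), yY⟫ := by
  have hXc : Continuous X := hX.continuous
  have hX'c : Continuous (deriv X) := hX.continuous_deriv le_rfl
  have hmpos : ∀ σ, 0 < m σ := fun σ => hm₀.trans_le (hm σ)
  have hk5 := continuous_kernel hXc hmc hmpos y (5 / 2 : ℝ)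
  have hk3 := continuous_kernel hXc hmc hmpos y (3 / 2 : ℝ)
  have hd : Continuous fun σ => y - X σ := continuous_const.sub hXc
  have hcr1 : Continuous fun σ => cross (deriv X σ) (y - X σ) := (crossCLM.continuous.comp hX'c).clm_apply hd
  have h1a : Integrable fun σ => (-3 * ⟪y - X σ, yY⟫ * ((‖y - X σ‖ ^ 2 + m σ) ^ (5 / 2 : ℝ))⁻¹) • cross (deriv X σ) (y - X σ) :=
    integrable_of_norm_le_inv y hm₀ hm hc hXg ((((continuous_const.mul (hd.inner continuous_const)).mul hk5)).smul hcr1)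
      (by positivity) fun σ => norm_kernel5_term_le hm₀ (hm σ) (hX1 σ)
  have h1b : Integrable fun σ => ((‖y - X σ‖ ^ 2 + m σ) ^ (3 / 2 : ℝ))⁻¹ • cross (deriv X σ) yY :=
    integrable_of_norm_le_inv y hm₀ hm hc hXg (hk3.smul ((crossCLM.continuous.comp hX'c).clm_apply continuous_const))
      (by positivity) fun σ => norm_kernel3_cross_le hm₀ (hm σ) (hX1 σ)
  have h2a : Integrable fun σ => (-3 * ((‖y - X σ‖ ^ 2 + m σ) ^ (5 / 2 : ℝ))⁻¹ * ⟪φ, cross (deriv X σ) (y - X σ)⟫) • (y - X σ) :=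
    integrable_of_norm_le_inv y hm₀ hm hc hXg (((continuous_const.mul hk5).mul (continuous_const.inner hcr1)).smul hd)
      (by positivity) fun σ => norm_kernel5_term_le' hm₀ (hm σ) (hX1 σ)
  have h2b : Integrable fun σ => ((‖y - X σ‖ ^ 2 + m σ) ^ (3 / 2 : ℝ))⁻¹ • cross φ (deriv X σ) :=
    integrable_of_norm_le_inv y hm₀ hm hc hXg (hk3.smul ((crossCLM φ).continuous.comp hX'c))
      (by positivity) fun σ => norm_kernel3_cross_le' hm₀ (hm σ) (hX1 σ)
  have h1 : Integrable fun σ => (-3 * ⟪y - X σ, yY⟫ * ((‖y - X σ‖ ^ 2 + m σ) ^ (5 / 2 : ℝ))⁻¹) • cross (deriv X σ) (y - X σ)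
      + ((‖y - X σ‖ ^ 2 + m σ) ^ (3 / 2 : ℝ))⁻¹ • cross (deriv X σ) yY := h1a.add h1b
  have h2 : Integrable fun σ => (-3 * ((‖y - X σ‖ ^ 2 + m σ) ^ (5 / 2 : ℝ))⁻¹ * ⟪φ, cross (deriv X σ) (y - X σ)⟫) • (y - X σ)
      + ((‖y - X σ‖ ^ 2 + m σ) ^ (3 / 2 : ℝ))⁻¹ • cross φ (deriv X σ) := h2a.add h2b
  rw [← integral_inner h1 φ, real_inner_comm, ← integral_inner h2 yY]
  refine integral_congr_ae (Eventually.of_forall fun σ => ?_)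
  show ⟪φ, _⟫ = ⟪yY, _⟫
  rw [inner_local_kernel_eq, real_inner_comm]

/-! ## §3 The nonlocal `Y` part: transpose pointwise, then Fubini over `τ ∈ S` -/

/-- Pointwise transposition of the nonlocal `Y` kernel. [folklore] -/
theorem inner_nonlocal_kernel_eq (φ z d a : EuclideanSpace ℝ (Fin 3)) (k5 k3 : ℝ) :
    ⟪φ, (3 * ⟪d, z⟫ * k5) • cross a d - k3 • cross a z⟫
      = ⟪(3 * k5 * ⟪φ, cross a d⟫) • d - k3 • cross φ a, z⟫ := by
  rw [inner_sub_right, inner_smul_right, inner_smul_right, inner_sub_left, inner_smul_left, inner_smul_left,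
    inner_cross_cyclic φ a z]
  simp only [conj_trivial]
  ring

/-- **The nonlocal `Y` part paired over the ball and swapped**: `S` compact, `φ, y` continuous weights/stations on `S` (`y τ = X_jτ`,
`φ τ = P_nψ_j(τ)`), `X ∈ C¹`, core `m` continuous positive, `Y` continuous with compact support. [folklore] -/
theorem setIntegral_inner_integral_nonlocal_eq {S : Set ℝ} (hS : IsCompact S) {φ y X Y : ℝ → EuclideanSpace ℝ (Fin 3)} {m : ℝ → ℝ}
    (hφ : Continuous φ) (hy : Continuous y) (hX : ContDiff ℝ 1 X) (hmc : Continuous m) (hmpos : ∀ σ, 0 < m σ)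
    (hY : Continuous Y) (hYc : HasCompactSupport Y) :
    ∫ τ in S, ⟪φ τ, ∫ σ, ((3 * ⟪y τ - X σ, Y σ⟫ * ((‖y τ - X σ‖ ^ 2 + m σ) ^ (5 / 2 : ℝ))⁻¹) • cross (deriv X σ) (y τ - X σ)
          - ((‖y τ - X σ‖ ^ 2 + m σ) ^ (3 / 2 : ℝ))⁻¹ • cross (deriv X σ) (Y σ))⟫
      = ∫ σ, ⟪∫ τ in S, ((3 * ((‖y τ - X σ‖ ^ 2 + m σ) ^ (5 / 2 : ℝ))⁻¹ * ⟪φ τ, cross (deriv X σ) (y τ - X σ)⟫) • (y τ - X σ)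
          - ((‖y τ - X σ‖ ^ 2 + m σ) ^ (3 / 2 : ℝ))⁻¹ • cross (φ τ) (deriv X σ)), Y σ⟫ := by
  have hXc : Continuous X := hX.continuous
  have hX'c : Continuous (deriv X) := hX.continuous_deriv le_rfl
  -- joint continuity of the transposed kernel `H(τ, σ)`
  have hd2 : Continuous fun p : ℝ × ℝ => y p.1 - X p.2 := (hy.comp continuous_fst).sub (hXc.comp continuous_snd)
  have hs2 : Continuous fun p : ℝ × ℝ => ‖y p.1 - X p.2‖ ^ 2 + m p.2 := (hd2.norm.pow 2).add (hmc.comp continuous_snd)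
  have hpos2 : ∀ p : ℝ × ℝ, 0 < ‖y p.1 - X p.2‖ ^ 2 + m p.2 := fun p => by have := hmpos p.2; positivity
  have hk52 : Continuous fun p : ℝ × ℝ => ((‖y p.1 - X p.2‖ ^ 2 + m p.2) ^ (5 / 2 : ℝ))⁻¹ :=
    (hs2.rpow_const fun p => Or.inl (hpos2 p).ne').inv₀ fun p => (Real.rpow_pos_of_pos (hpos2 p) _).ne'
  have hk32 : Continuous fun p : ℝ × ℝ => ((‖y p.1 - X p.2‖ ^ 2 + m p.2) ^ (3 / 2 : ℝ))⁻¹ :=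
    (hs2.rpow_const fun p => Or.inl (hpos2 p).ne').inv₀ fun p => (Real.rpow_pos_of_pos (hpos2 p) _).ne'
  have hcr2 : Continuous fun p : ℝ × ℝ => cross (deriv X p.2) (y p.1 - X p.2) :=
    (crossCLM.continuous.comp (hX'c.comp continuous_snd)).clm_apply hd2
  have hcr3 : Continuous fun p : ℝ × ℝ => cross (φ p.1) (deriv X p.2) :=
    (crossCLM.continuous.comp (hφ.comp continuous_fst)).clm_apply (hX'c.comp continuous_snd)
  have hH : Continuous (Function.uncurry fun τ σ =>
      (3 * ((‖y τ - X σ‖ ^ 2 + m σ) ^ (5 / 2 : ℝ))⁻¹ * ⟪φ τ, cross (deriv X σ) (y τ - X σ)⟫) • (y τ - X σ)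
        - ((‖y τ - X σ‖ ^ 2 + m σ) ^ (3 / 2 : ℝ))⁻¹ • cross (φ τ) (deriv X σ)) :=
    (((continuous_const.mul hk52).mul ((hφ.comp continuous_fst).inner hcr2)).smul hd2).sub (hk32.smul hcr3)
  have hg : Continuous (Function.uncurry fun τ σ =>
      ⟪(3 * ((‖y τ - X σ‖ ^ 2 + m σ) ^ (5 / 2 : ℝ))⁻¹ * ⟪φ τ, cross (deriv X σ) (y τ - X σ)⟫) • (y τ - X σ)
        - ((‖y τ - X σ‖ ^ 2 + m σ) ^ (3 / 2 : ℝ))⁻¹ • cross (φ τ) (deriv X σ), Y σ⟫) :=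
    hH.inner (hY.comp continuous_snd)
  -- Step 1: pointwise in `τ`, move `φ τ` inside and transpose
  have hstep1 : ∀ τ, ⟪φ τ, ∫ σ, ((3 * ⟪y τ - X σ, Y σ⟫ * ((‖y τ - X σ‖ ^ 2 + m σ) ^ (5 / 2 : ℝ))⁻¹) • cross (deriv X σ) (y τ - X σ)
          - ((‖y τ - X σ‖ ^ 2 + m σ) ^ (3 / 2 : ℝ))⁻¹ • cross (deriv X σ) (Y σ))⟫
      = ∫ σ, ⟪(3 * ((‖y τ - X σ‖ ^ 2 + m σ) ^ (5 / 2 : ℝ))⁻¹ * ⟪φ τ, cross (deriv X σ) (y τ - X σ)⟫) • (y τ - X σ)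
          - ((‖y τ - X σ‖ ^ 2 + m σ) ^ (3 / 2 : ℝ))⁻¹ • cross (φ τ) (deriv X σ), Y σ⟫ := by
    intro τ
    have hcont : Continuous fun σ => (3 * ⟪y τ - X σ, Y σ⟫ * ((‖y τ - X σ‖ ^ 2 + m σ) ^ (5 / 2 : ℝ))⁻¹) • cross (deriv X σ) (y τ - X σ)
        - ((‖y τ - X σ‖ ^ 2 + m σ) ^ (3 / 2 : ℝ))⁻¹ • cross (deriv X σ) (Y σ) := by
      have hd : Continuous fun σ => y τ - X σ := continuous_const.sub hXc
      have hk5 := continuous_kernel hXc hmc hmpos (y τ) (5 / 2 : ℝ)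
      have hk3 := continuous_kernel hXc hmc hmpos (y τ) (3 / 2 : ℝ)
      exact (((continuous_const.mul (hd.inner hY)).mul hk5).smul ((crossCLM.continuous.comp hX'c).clm_apply hd)).sub
        (hk3.smul ((crossCLM.continuous.comp hX'c).clm_apply hY))
    have hint : Integrable fun σ => (3 * ⟪y τ - X σ, Y σ⟫ * ((‖y τ - X σ‖ ^ 2 + m σ) ^ (5 / 2 : ℝ))⁻¹) • cross (deriv X σ) (y τ - X σ)
        - ((‖y τ - X σ‖ ^ 2 + m σ) ^ (3 / 2 : ℝ))⁻¹ • cross (deriv X σ) (Y σ) := by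
      refine hcont.integrable_of_hasCompactSupport (HasCompactSupport.intro hYc fun σ hσ => ?_)
      rw [image_eq_zero_of_notMem_tsupport hσ, inner_zero_right,
      ← crossCLM_apply (deriv X σ) (0 : EuclideanSpace ℝ (Fin 3)), map_zero]
      simp
    rw [← integral_inner hint (φ τ)]
    refine integral_congr_ae (Eventually.of_forall fun σ => ?_)
    exact inner_nonlocal_kernel_eq (φ τ) (Y σ) (y τ - X σ) (deriv X σ) _ _
  rw [integral_congr_ae (Eventually.of_forall fun τ => hstep1 τ)]
  -- Step 2: Fubini (density continuous, supported in `σ ∈ tsupport Y`)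
  rw [setIntegral_integral_swap_of_continuous hS hYc hg (fun τ σ hσ => by
    show ⟪_, Y σ⟫ = 0
    rw [image_eq_zero_of_notMem_tsupport hσ, inner_zero_right])]
  -- Step 3: pull `Y σ` out of the `τ`-integral
  refine integral_congr_ae (Eventually.of_forall fun σ => ?_)
  exact setIntegral_inner_const ((hH.comp (Continuous.prodMk_left σ)).continuousOn.integrableOn_compact hS) (Y σ)

/-! ## §4 The `Y′` part: by parts in `σ`, then Fubini over `τ ∈ S` -/

/-- **The `Y′` part paired over the ball, by parts in `σ` and swapped**: as in §4, with the core equal to `a₀ > 0` on an open `U ⊇ tsupport Y`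
(clause 13: the core is constant on the double ball) and `Y ∈ C¹`. [folklore] -/
theorem setIntegral_inner_integral_derivTerm_eq {S : Set ℝ} (hS : IsCompact S) {φ y X Y : ℝ → EuclideanSpace ℝ (Fin 3)} {m : ℝ → ℝ}
    (hφ : Continuous φ) (hy : Continuous y) (hX : ContDiff ℝ 1 X) (hmc : Continuous m) (hmpos : ∀ σ, 0 < m σ)
    {a₀ : ℝ} (ha₀ : 0 < a₀) {U : Set ℝ} (hU : IsOpen U) (hmU : ∀ σ ∈ U, m σ = a₀)
    (hY : ContDiff ℝ 1 Y) (hYc : HasCompactSupport Y) (hYU : tsupport Y ⊆ U) :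
    ∫ τ in S, ⟪φ τ, ∫ σ, ((‖y τ - X σ‖ ^ 2 + m σ) ^ (3 / 2 : ℝ))⁻¹ • cross (deriv Y σ) (y τ - X σ)⟫
      = - ∫ σ, ⟪∫ τ in S, ((3 * ⟪y τ - X σ, deriv X σ⟫ * ((‖y τ - X σ‖ ^ 2 + a₀) ^ (5 / 2 : ℝ))⁻¹) • cross (φ τ) (X σ - y τ)
          + ((‖y τ - X σ‖ ^ 2 + a₀) ^ (3 / 2 : ℝ))⁻¹ • cross (φ τ) (deriv X σ)), Y σ⟫ := by
  have hXc : Continuous X := hX.continuous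
  have hX'c : Continuous (deriv X) := hX.continuous_deriv le_rfl
  have hYcont : Continuous Y := hY.continuous
  have hY'c : Continuous (deriv Y) := hY.continuous_deriv le_rfl
  -- joint continuity of `G′(τ, σ)`
  have hd2 : Continuous fun p : ℝ × ℝ => y p.1 - X p.2 := (hy.comp continuous_fst).sub (hXc.comp continuous_snd)
  have hd2' : Continuous fun p : ℝ × ℝ => X p.2 - y p.1 := (hXc.comp continuous_snd).sub (hy.comp continuous_fst)
  have hs2 : Continuous fun p : ℝ × ℝ => ‖y p.1 - X p.2‖ ^ 2 + a₀ := (hd2.norm.pow 2).add continuous_const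
  have hpos2 : ∀ p : ℝ × ℝ, 0 < ‖y p.1 - X p.2‖ ^ 2 + a₀ := fun p => by positivity
  have hk52 : Continuous fun p : ℝ × ℝ => ((‖y p.1 - X p.2‖ ^ 2 + a₀) ^ (5 / 2 : ℝ))⁻¹ :=
    (hs2.rpow_const fun p => Or.inl (hpos2 p).ne').inv₀ fun p => (Real.rpow_pos_of_pos (hpos2 p) _).ne'
  have hk32 : Continuous fun p : ℝ × ℝ => ((‖y p.1 - X p.2‖ ^ 2 + a₀) ^ (3 / 2 : ℝ))⁻¹ :=
    (hs2.rpow_const fun p => Or.inl (hpos2 p).ne').inv₀ fun p => (Real.rpow_pos_of_pos (hpos2 p) _).ne'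
  have hcr2 : Continuous fun p : ℝ × ℝ => cross (φ p.1) (X p.2 - y p.1) :=
    (crossCLM.continuous.comp (hφ.comp continuous_fst)).clm_apply hd2'
  have hcr3 : Continuous fun p : ℝ × ℝ => cross (φ p.1) (deriv X p.2) :=
    (crossCLM.continuous.comp (hφ.comp continuous_fst)).clm_apply (hX'c.comp continuous_snd)
  have hH : Continuous (Function.uncurry fun τ σ =>
      (3 * ⟪y τ - X σ, deriv X σ⟫ * ((‖y τ - X σ‖ ^ 2 + a₀) ^ (5 / 2 : ℝ))⁻¹) • cross (φ τ) (X σ - y τ)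
        + ((‖y τ - X σ‖ ^ 2 + a₀) ^ (3 / 2 : ℝ))⁻¹ • cross (φ τ) (deriv X σ)) :=
    (((continuous_const.mul (hd2.inner (hX'c.comp continuous_snd))).mul hk52).smul hcr2).add (hk32.smul hcr3)
  have hg : Continuous (Function.uncurry fun τ σ =>
      ⟪(3 * ⟪y τ - X σ, deriv X σ⟫ * ((‖y τ - X σ‖ ^ 2 + a₀) ^ (5 / 2 : ℝ))⁻¹) • cross (φ τ) (X σ - y τ)
        + ((‖y τ - X σ‖ ^ 2 + a₀) ^ (3 / 2 : ℝ))⁻¹ • cross (φ τ) (deriv X σ), Y σ⟫) :=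
    hH.inner (hYcont.comp continuous_snd)
  -- Step 1: pointwise in `τ`, move `φ τ` inside and integrate by parts in `σ`
  have hstep1 : ∀ τ, ⟪φ τ, ∫ σ, ((‖y τ - X σ‖ ^ 2 + m σ) ^ (3 / 2 : ℝ))⁻¹ • cross (deriv Y σ) (y τ - X σ)⟫
      = - ∫ σ, ⟪(3 * ⟪y τ - X σ, deriv X σ⟫ * ((‖y τ - X σ‖ ^ 2 + a₀) ^ (5 / 2 : ℝ))⁻¹) • cross (φ τ) (X σ - y τ)
          + ((‖y τ - X σ‖ ^ 2 + a₀) ^ (3 / 2 : ℝ))⁻¹ • cross (φ τ) (deriv X σ), Y σ⟫ := by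
    intro τ
    have hcont : Continuous fun σ => ((‖y τ - X σ‖ ^ 2 + m σ) ^ (3 / 2 : ℝ))⁻¹ • cross (deriv Y σ) (y τ - X σ) :=
      (continuous_kernel hXc hmc hmpos (y τ) (3 / 2 : ℝ)).smul
        ((crossCLM.continuous.comp hY'c).clm_apply (continuous_const.sub hXc))
    have hint : Integrable fun σ => ((‖y τ - X σ‖ ^ 2 + m σ) ^ (3 / 2 : ℝ))⁻¹ • cross (deriv Y σ) (y τ - X σ) := by
      refine hcont.integrable_of_hasCompactSupport (HasCompactSupport.intro hYc.deriv fun σ hσ => ?_)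
      rw [image_eq_zero_of_notMem_tsupport hσ, ← crossCLM_apply (0 : EuclideanSpace ℝ (Fin 3)), map_zero]
      simp
    rw [← integral_inner hint (φ τ)]
    exact integral_inner_kernel_cross_deriv_eq_neg hX (y τ) (φ τ) hmc hmpos ha₀ hU hmU hY hYc hYU
  rw [integral_congr_ae (Eventually.of_forall fun τ => hstep1 τ), integral_neg]
  -- Step 2: Fubini; Step 3: pull `Y σ` out
  rw [setIntegral_integral_swap_of_continuous hS hYc hg (fun τ σ hσ => by
    show ⟪_, Y σ⟫ = 0
    rw [image_eq_zero_of_notMem_tsupport hσ, inner_zero_right])]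
  congr 1
  refine integral_congr_ae (Eventually.of_forall fun σ => ?_)
  exact setIntegral_inner_const ((hH.comp (Continuous.prodMk_left σ)).continuousOn.integrableOn_compact hS) (Y σ)

end Summit.NavierStokesRegularity.NavierStokesRegularity.Theorems.Clause13RPairwiseAdjoint

end
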